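import Literature.AlgebraicGeometry.Motives.GeneratesHomExtReduced
import Literature.AlgebraicGeometry.Motives.AlgPointsSeparate
import Literature.AlgebraicGeometry.Motives.AbelianVarietyFrobeniusTwist
import Literature.NumberTheory.DiophantineGeometry.AVIsogenyTate
import HarnessLib

/-!
# Endomorphism identities of an abelian variety are decided pointwise on a generating family;
# the Frobenius case («`T₁ ∘ π = d π² + q T₂`» from its values on generators)

Topic `Literature/AlgebraicGeometry/Motives`, namespace `Literature.AlgebraicGeometry.Motives.AbelianVariety`.
THEOREMS ONLY (no definition, no named fact, no instance, no `sorry`).  Cell `hodgecm-mathlib`, FLOOR-0 sub-programme F0P5a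
(D9op road 2′), the TRANSPORT half of the next cut `stub_L3a ⇐ C*` of the registered line `Cruxes/HLiu418/Lines/F0_D9opRoad2.lean`
(LEAD WORD #3 2026-08-30; F0P5a-plan PLAN v1 §4 ed. 3; F0P5a-p02 census c2cf9400∕bbe595f5 §2 C*): the Eichler–Shimura relation in
`End Ā` follows from its POINTWISE form on any smooth generating family `φ : Z → Ā` — because `Ā(κ̄)`-points separate
`κ`-morphisms out of a reduced source (★ `SchemeOver.hom_ext_of_forall_algPoints`, [MumfordAV1970] §4) and homomorphisms out of a
generated abelian variety are determined on the generators (★ `Generates.hom_ext_of_smoothOfRelativeDimension`,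
[Lang1983AbelianVarieties] II §3 p. 35) — and the Frobenius endomorphism `π` of `Ā` acts on `φ(z)` as `φ(F_Z z)` (naturality of the
`q`-Frobenius, ★ `frobeniusOver_comp`, [Tate1966Endomorphisms] §1).  HC_CM is proved only modulo the 7 printed citations until rung 0
closes; this file moves no book.

## What is proved (any field `k`; `Finite k` for §2)

* §1 `hom_eq_of_generates_of_forall_geomPointsMap_eq` — two homomorphisms `u, v : A ⟶ B` agreeing on the geometric points `φ(z)`,
  `z ∈ Z(k̄)`, of a generating morphism `φ : Z ⟶ A` with `Z` smooth of some relative dimension and locally of finite type, are equal.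
* §2 `geomPointsMap_frobeniusHom_ofMul_map` — `π(φ(z)) = φ(F_Z(z))` on `k̄`-points; and the ENTRY POINT of ed. 3 of the D9op line,
  **`mul_frobeniusHom_eq_of_forall_geomPoints`**: for `T₁, T₂ ∈ End A`, integers `d, q` and a smooth generating `φ : Z ⟶ A`, the pointwise
  identities `T₁(φ(F z)) = d • φ(F² z) + q • T₂(φ(z))` (`z ∈ Z(k̄)`, in the group `A(k̄)`) give
  `T₁ * π = d • (π * π) + q • T₂` in `End A` (`End.mul` order: `T₁ * π` = `π` FIRST) — the «ES·π» shape of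
  `RecordCurveEichlerShimuraHonest` with `(T₁, T₂) := (R.redEnd 𝒯₁, R.redEnd 𝒯₂)`, `A := R.reduction`.

## References
* [MumfordAV1970] D. Mumford, *Abelian Varieties*, §4 (geometric points separate morphisms), §19 (pointwise addition of homomorphisms).
* [Lang1983AbelianVarieties] S. Lang, *Abelian Varieties*, II §3 (p. 35) (generation; uniqueness of induced homomorphisms).
* [Tate1966Endomorphisms] J. Tate, *Endomorphisms of abelian varieties over finite fields*, Invent. Math. 2 (1966), §1 (the Frobenius
  endomorphism commutes with every morphism).
* [Liu2021] Y. Liu, *Fourier–Jacobi cycles and arithmetic relative trace formula*, Camb. J. Math. 9 (2021), App. D proof of Cor. D.9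
  (p. 139) (the relation read on the special fibre «on `T_K`»).
-/

set_option autoImplicit false

noncomputable section

universe u

open CategoryTheory

namespace Literature.AlgebraicGeometry.Motives.AbelianVariety

variable {k : Type u} [Field k] {A B : AbelianVariety k} {Z : SchemeOver k}

/-! ## §1 Homomorphisms agreeing on the geometric points of a generating family are equal -/

/-- **Pointwise criterion on generators**: if `φ : Z ⟶ A` generates `A` ([Lang1983AbelianVarieties] II §3), `Z` is smooth of some relative
dimension over `k` (hence reduced) and locally of finite type, and `u, v : A ⟶ B` satisfy `u(φ(z)) = v(φ(z))` for every `z ∈ Z(k̄)`, then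
`u = v`: `k̄`-points separate the `k`-morphisms `φ ≫ u`, `φ ≫ v` ([MumfordAV1970] §4, ★ `SchemeOver.hom_ext_of_forall_algPoints`), and `φ`
generates (★ `Generates.hom_ext_of_smoothOfRelativeDimension`).
[cite: Lang1983AbelianVarieties, II §3 (p. 35)] [cite: MumfordAV1970, §4] -/
theorem hom_eq_of_generates_of_forall_geomPointsMap_eq {dZ : ℕ} [AlgebraicGeometry.SmoothOfRelativeDimension dZ Z.hom]
    [AlgebraicGeometry.LocallyOfFiniteType Z.hom] {φ : Z ⟶ A.X} (hφ : Generates φ) {u v : A ⟶ B}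
    (h : ∀ z : AlgPoints Z (AlgebraicClosure k),
      Hom.geomPointsMap u (Additive.ofMul (AlgPoints.map φ z)) = Hom.geomPointsMap v (Additive.ofMul (AlgPoints.map φ z))) :
    u = v := by
  haveI : AlgebraicGeometry.IsReduced Z.left := isReduced_of_smoothOfRelativeDimension Z.hom dZ
  refine Generates.hom_ext_of_smoothOfRelativeDimension (d := dZ) hφ
    (SchemeOver.hom_ext_of_forall_algPoints (AlgebraicClosure k) fun z => ?_)
  have hz := congrArg Additive.toMul (h z)
  simp only [Hom.geomPointsMap_ofMul, toMul_ofMul, AlgPoints.map_apply] at hz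
  simpa only [Category.assoc] using hz

/-! ## §2 The Frobenius endomorphism on generators, and the «ES·π» shape -/

section Frobenius

variable [Finite k]

/-- **`π(φ(z)) = φ(F_Z(z))`** on `k̄`-points: the `q`-Frobenius endomorphism `π = frobeniusHom A` acts on the image of a `k`-morphism
`φ : Z ⟶ A` through the `q`-Frobenius of `Z` (naturality ★ `frobeniusOver_comp`; [Tate1966Endomorphisms] §1).
[cite: Tate1966Endomorphisms, §1] -/
theorem geomPointsMap_frobeniusHom_ofMul_map (φ : Z ⟶ A.X) (z : AlgPoints Z (AlgebraicClosure k)) :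
    Hom.geomPointsMap (frobeniusHom A) (Additive.ofMul (AlgPoints.map φ z)) =
      Additive.ofMul (AlgPoints.map φ (AlgPoints.map (frobeniusOver Z) z)) := by
  rw [Hom.geomPointsMap_ofMul, frobeniusHom_hom_hom_hom, AlgPoints.map_apply, AlgPoints.map_apply, AlgPoints.map_apply,
    AlgPoints.map_apply, Category.assoc, Category.assoc, frobeniusOver_comp φ]

/-- `π²(φ(z)) = φ(F_Z²(z))` on `k̄`-points. [cite: Tate1966Endomorphisms, §1] -/
theorem geomPointsMap_frobeniusHom_sq_ofMul_map (φ : Z ⟶ A.X) (z : AlgPoints Z (AlgebraicClosure k)) :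
    Hom.geomPointsMap ((End.of (frobeniusHom A) * End.of (frobeniusHom A) : End A) : A ⟶ A) (Additive.ofMul (AlgPoints.map φ z)) =
      Additive.ofMul (AlgPoints.map φ (AlgPoints.map (frobeniusOver Z) (AlgPoints.map (frobeniusOver Z) z))) := by
  rw [End.mul_def, End.of, Hom.geomPointsMap_comp, AddMonoidHom.comp_apply, geomPointsMap_frobeniusHom_ofMul_map,
    geomPointsMap_frobeniusHom_ofMul_map]

/-- **The «ES·π» shape from its values on generators.**  Let `A` be an abelian variety over a finite field `k` with `q`-Frobenius
`π = frobeniusHom A`, `T₁, T₂ ∈ End A`, `d, q' : ℤ`, and `φ : Z ⟶ A` a generating `k`-morphism from a smooth `Z` locally of finite type.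
If for every `z ∈ Z(k̄)`, in the group `A(k̄)` (additive notation),
`T₁(φ(F_Z z)) = d • φ(F_Z² z) + q' • T₂(φ(z))`, then `T₁ * π = d • (π * π) + q' • T₂` in `End A` (`End.mul`: `π` first) — the pointwise
reading of the Eichler–Shimura relation «on `T_K`» ([Liu2021] p. 139) transported to the endomorphism ring.  (The middle term is written
`geomPointsMap (𝟙 A) (…)`, the identity of `A(k̄)` (★ `geomPointsMap_id`), only to keep the three summands in the additive type `A.geomPoints`.)
[cite: Liu2021, App. D proof of Cor. D.9 (p. 139)] [cite: Lang1983AbelianVarieties, II §3 (p. 35)] [cite: MumfordAV1970, §4] -/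
theorem mul_frobeniusHom_eq_of_forall_geomPoints {dZ : ℕ} [AlgebraicGeometry.SmoothOfRelativeDimension dZ Z.hom]
    [AlgebraicGeometry.LocallyOfFiniteType Z.hom] {φ : Z ⟶ A.X} (hφ : Generates φ) (T₁ T₂ : End A) (d q' : ℤ)
    (h : ∀ z : AlgPoints Z (AlgebraicClosure k),
      Hom.geomPointsMap (T₁ : A ⟶ A) (Additive.ofMul (AlgPoints.map φ (AlgPoints.map (frobeniusOver Z) z))) =
        d • Hom.geomPointsMap (𝟙 A) (Additive.ofMul (AlgPoints.map φ (AlgPoints.map (frobeniusOver Z) (AlgPoints.map (frobeniusOver Z) z)))) +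
          q' • Hom.geomPointsMap (T₂ : A ⟶ A) (Additive.ofMul (AlgPoints.map φ z))) :
    T₁ * End.of (frobeniusHom A) = d • (End.of (frobeniusHom A) * End.of (frobeniusHom A)) + q' • T₂ := by
  refine hom_eq_of_generates_of_forall_geomPointsMap_eq (dZ := dZ) hφ fun z => ?_
  -- left: `(T₁ * π)(φ z) = T₁ (π (φ z)) = T₁ (φ (F z))`
  have lhs : Hom.geomPointsMap ((T₁ * End.of (frobeniusHom A) : End A) : A ⟶ A) (Additive.ofMul (AlgPoints.map φ z)) =
      Hom.geomPointsMap (T₁ : A ⟶ A) (Additive.ofMul (AlgPoints.map φ (AlgPoints.map (frobeniusOver Z) z))) := by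
    rw [End.mul_def, End.of, Hom.geomPointsMap_comp, AddMonoidHom.comp_apply, geomPointsMap_frobeniusHom_ofMul_map]
  -- right: additivity of `f ↦ f(P)` in `f`
  have rhs : Hom.geomPointsMap ((d • (End.of (frobeniusHom A) * End.of (frobeniusHom A)) + q' • T₂ : End A) : A ⟶ A)
        (Additive.ofMul (AlgPoints.map φ z)) =
      d • Hom.geomPointsMap (𝟙 A) (Additive.ofMul (AlgPoints.map φ (AlgPoints.map (frobeniusOver Z) (AlgPoints.map (frobeniusOver Z) z)))) +
        q' • Hom.geomPointsMap (T₂ : A ⟶ A) (Additive.ofMul (AlgPoints.map φ z)) := by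
    have e : Hom.geomPointsMap ((d • (End.of (frobeniusHom A) * End.of (frobeniusHom A)) + q' • T₂ : End A) : A ⟶ A) =
        d • Hom.geomPointsMap ((End.of (frobeniusHom A) * End.of (frobeniusHom A) : End A) : A ⟶ A) +
          q' • Hom.geomPointsMap (T₂ : A ⟶ A) := by
      rw [← Hom.geomPointsMapAddMonoidHom_apply, ← Hom.geomPointsMapAddMonoidHom_apply, ← Hom.geomPointsMapAddMonoidHom_apply,
        ← map_zsmul, ← map_zsmul, ← map_add]
      rfl
    rw [e, AddMonoidHom.add_apply, AddMonoidHom.zsmul_apply, AddMonoidHom.zsmul_apply, geomPointsMap_frobeniusHom_sq_ofMul_map,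
      Hom.geomPointsMap_id, AddMonoidHom.id_apply]
  rw [lhs, rhs]
  exact h z

end Frobenius

end Literature.AlgebraicGeometry.Motives.AbelianVariety

end
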